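import Summits.CriticalPhenomena.PercolationContinuityZ3.Theses.PercNonSelfAveraging
import Summits.CriticalPhenomena.PercolationContinuityZ3.Theorems.PercNonSelfAveragingLowerTailLadder
import Summits.CriticalPhenomena.PercolationContinuityZ3.Theorems.PercNonSelfAveragingStrictFKGLadder

/-!
# Piece X1 `ClusterMassAnticoncentration` is on the WEAK side of the crux `ArmMassNSA`

Record for the BC2 audit of the decomposition `ArmMassNSA ⟸ ClusterMassAnticoncentration ∧ NonProliferation`
(strategist cstrat-7058): the EVENTUALLY-form of the crux implies X1.  Pointwise
`Q_n = #{(x,y) : A_x, x ↔ y in B(2n)} ≤ M_n²` (if `x` is armed and `x ↔ y` inside `B(2n)` then `y` is armed), so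
`E[Q_n] ≤ E[M_n²] = Var(M_n) + (E M_n)²`; hence `c (E M_n)² ≤ Var(M_n)` gives `(c/(1+c)) E[Q_n] ≤ Var(M_n)`.
So X1 is a CONSEQUENCE of "`Var(M_n) ≥ c (E M_n)²` for all large `n`" — it cannot be stronger than the crux —
while the converse direction needs the independent input `NonProliferation` (the proved glue).
-/

noncomputable section

namespace Summit.CriticalPhenomena.PercolationContinuityZ3.Cruxes.ArmMassNSA.SplitNonproliferationWeaker

open MeasureTheory ProbabilityTheory Filter
open Literature.Probability.LatticeModels Literature.Probability.Percolation
open Summit.CriticalPhenomena.PercolationContinuityZ3.Theorems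
open scoped Classical

section Abstract

variable {Ω ι : Type*} (B : Finset ι) (A : ι → Set Ω) (C : ι → ι → Set Ω)

/-- Pointwise `Q ≤ M²`: if `A x ∩ C x y ⊆ A y` then
`Σ_{x,y} 1_{A x ∩ C x y} ≤ (Σ_x 1_{A x})²`. [folklore] -/
theorem sum_sum_indicator_inter_le_sq (ω : Ω) (hAC : ∀ x y, ω ∈ A x → ω ∈ C x y → ω ∈ A y) :
    ∑ x ∈ B, ∑ y ∈ B, (A x ∩ C x y).indicator (fun _ => (1 : ℝ)) ω ≤
      (∑ x ∈ B, (A x).indicator (fun _ => (1 : ℝ)) ω) ^ 2 := by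
  rw [sq, Finset.sum_mul_sum]
  refine Finset.sum_le_sum fun x _ => Finset.sum_le_sum fun y _ => ?_
  by_cases h : ω ∈ A x ∩ C x y
  · rw [Set.indicator_of_mem h, Set.indicator_of_mem h.1, Set.indicator_of_mem (hAC x y h.1 h.2)]
    norm_num
  · rw [Set.indicator_of_notMem h]
    exact mul_nonneg (Set.indicator_nonneg (fun _ _ => zero_le_one) ω)
      (Set.indicator_nonneg (fun _ _ => zero_le_one) ω)

variable [MeasurableSpace Ω] (μ : Measure Ω) [IsProbabilityMeasure μ]

/-- `E[Q] ≤ Var(M) + (E M)²`. [folklore] -/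
theorem sum_sum_measureReal_inter_le (hA : ∀ x, MeasurableSet (A x)) (hC : ∀ x y, MeasurableSet (C x y))
    (hAC : ∀ x y ω, ω ∈ A x → ω ∈ C x y → ω ∈ A y) :
    ∑ x ∈ B, ∑ y ∈ B, μ.real (A x ∩ C x y) ≤
      Var[fun ω => ∑ x ∈ B, (A x).indicator (fun _ => (1 : ℝ)) ω; μ] +
        (∫ ω, (∑ x ∈ B, (A x).indicator (fun _ => (1 : ℝ)) ω) ∂μ) ^ 2 := by
  have hmem : MemLp (fun ω => ∑ x ∈ B, (A x).indicator (fun _ => (1 : ℝ)) ω) 2 μ :=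
    memLp_two_sum_indicator_one μ B A fun x _ => hA x
  rw [variance_eq_sub hmem, sub_add_cancel]
  -- E[Q] as an integral
  have hQ : ∑ x ∈ B, ∑ y ∈ B, μ.real (A x ∩ C x y) =
      ∫ ω, (∑ x ∈ B, ∑ y ∈ B, (A x ∩ C x y).indicator (fun _ => (1 : ℝ)) ω) ∂μ := by
    rw [integral_finsetSum _ fun x _ => ?_]
    · refine Finset.sum_congr rfl fun x _ => ?_
      exact (integral_sum_indicator_one μ B _ fun y _ => (hA x).inter (hC x y)).symm
    · exact integrable_finsetSum _ fun y _ =>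
        (integrable_const (1 : ℝ)).indicator ((hA x).inter (hC x y))
  rw [hQ]
  refine integral_mono ?_ hmem.integrable_sq fun ω => ?_
  · exact integrable_finsetSum _ fun x _ => integrable_finsetSum _ fun y _ =>
      (integrable_const (1 : ℝ)).indicator ((hA x).inter (hC x y))
  · simpa only [Pi.pow_apply] using
      sum_sum_indicator_inter_le_sq B A C ω fun x y hx hxy => hAC x y ω hx hxy

/-- **The eventually-form of the Binder ratio bound implies the squared-cluster-moment bound.**
If `c (E M)² ≤ Var(M)` then `(c/(1+c)) E[Q] ≤ Var(M)` (abstract form). [folklore] -/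
theorem anticoncentration_of_binder (hA : ∀ x, MeasurableSet (A x)) (hC : ∀ x y, MeasurableSet (C x y))
    (hAC : ∀ x y ω, ω ∈ A x → ω ∈ C x y → ω ∈ A y) {c : ℝ} (hc : 0 < c)
    (h : c * (∫ ω, (∑ x ∈ B, (A x).indicator (fun _ => (1 : ℝ)) ω) ∂μ) ^ 2 ≤
      Var[fun ω => ∑ x ∈ B, (A x).indicator (fun _ => (1 : ℝ)) ω; μ]) :
    c / (1 + c) * (∑ x ∈ B, ∑ y ∈ B, μ.real (A x ∩ C x y)) ≤
      Var[fun ω => ∑ x ∈ B, (A x).indicator (fun _ => (1 : ℝ)) ω; μ] := by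
  have hle := sum_sum_measureReal_inter_le B A C μ hA hC hAC
  set V := Var[fun ω => ∑ x ∈ B, (A x).indicator (fun _ => (1 : ℝ)) ω; μ]
  set E := ∫ ω, (∑ x ∈ B, (A x).indicator (fun _ => (1 : ℝ)) ω) ∂μ
  have hV0 : 0 ≤ V := variance_nonneg _ _
  have h1c : 0 < 1 + c := by linarith
  rw [div_mul_eq_mul_div, div_le_iff₀ h1c]
  have hQ0 : 0 ≤ ∑ x ∈ B, ∑ y ∈ B, μ.real (A x ∩ C x y) :=
    Finset.sum_nonneg fun _ _ => Finset.sum_nonneg fun _ _ => measureReal_nonneg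
  nlinarith

end Abstract

/-- **`ArmMassNSA` (eventually-form) ⟹ `ClusterMassAnticoncentration`.** With
`A_x = {x ↔ ∂⁻B(2n) in B(2n)}` and `C x y = {x ↔ y in B(2n)}` one has `A_x ∩ C x y ⊆ A_y` (transitivity of
in-box connection), so the abstract lemma applies at every large `n` with the constant `c/(1+c)`. [folklore] -/
theorem clusterMassAnticoncentration_of_armMassNSA_eventually
    (h : ∃ c : ℝ, 0 < c ∧ ∀ᶠ n : ℕ in Filter.atTop, c * (∫ ω, (∑ x ∈ Literature.Probability.LatticeModels.box 3 n, Set.indicator {ω' | ∃ y ∈ Literature.Probability.LatticeModels.innerBoundary (Literature.Probability.LatticeModels.zdGraph 3) (Literature.Probability.LatticeModels.box 3 (2 * n)), ω' ∈ Literature.Probability.Percolation.openConnIn ↑(Literature.Probability.LatticeModels.box 3 (2 * n)) x y} (fun _ => (1 : ℝ)) ω) ∂(Literature.Probability.Percolation.bondPercolation (Literature.Probability.LatticeModels.zdGraph 3) (Literature.Probability.Percolation.criticalProbI 3))) ^ 2 ≤ ProbabilityTheory.variance (fun ω => ∑ x ∈ Literature.Probability.LatticeModels.box 3 n, Set.indicator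 {ω' | ∃ y ∈ Literature.Probability.LatticeModels.innerBoundary (Literature.Probability.LatticeModels.zdGraph 3) (Literature.Probability.LatticeModels.box 3 (2 * n)), ω' ∈ Literature.Probability.Percolation.openConnIn ↑(Literature.Probability.LatticeModels.box 3 (2 * n)) x y} (fun _ => (1 : ℝ)) ω) (Literature.Probability.Percolation.bondPercolation (Literature.Probability.LatticeModels.zdGraph 3) (Literature.Probability.Percolation.criticalProbI 3))) :
    ∃ c : ℝ, 0 < c ∧ ∀ᶠ n : ℕ in Filter.atTop, c * (∑ x ∈ Literature.Probability.LatticeModels.box 3 n, ∑ y ∈ Literature.Probability.LatticeModels.box 3 n, (Literature.Probability.Percolation.bondPercolation (Literature.Probability.LatticeModels.zdGraph 3) (Literature.Probability.Percolation.criticalProbI 3)).real ({ω | ∃ z ∈ Literature.Probability.LatticeModels.innerBoundary (Literature.Probability.LatticeModels.zdGraph 3) (Literature.Probability.LatticeModels.box 3 (2 * n)), ω ∈ Literature.Probability.Percolation.openConnIn ↑(Literature.Probability.LatticeModels.box 3 (2 * n)) x z} ∩ Literature.Probability.Percolation.openConnIn ↑(Literature.Probability.LatticeModels.box 3 (2 *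 n)) x y)) ≤ ProbabilityTheory.variance (fun ω => ∑ x ∈ Literature.Probability.LatticeModels.box 3 n, Set.indicator {ω' | ∃ y ∈ Literature.Probability.LatticeModels.innerBoundary (Literature.Probability.LatticeModels.zdGraph 3) (Literature.Probability.LatticeModels.box 3 (2 * n)), ω' ∈ Literature.Probability.Percolation.openConnIn ↑(Literature.Probability.LatticeModels.box 3 (2 * n)) x y} (fun _ => (1 : ℝ)) ω) (Literature.Probability.Percolation.bondPercolation (Literature.Probability.LatticeModels.zdGraph 3) (Literature.Probability.Percolation.criticalProbI 3)) := by
  obtain ⟨c, hc, hev⟩ := h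
  refine ⟨c / (1 + c), by positivity, ?_⟩
  filter_upwards [hev] with n hn
  refine anticoncentration_of_binder (box 3 n)
    (fun x => {ω' : BondConfig (Site 3) | ∃ y ∈ innerBoundary (zdGraph 3) (box 3 (2 * n)),
      ω' ∈ openConnIn (↑(box 3 (2 * n)) : Set (Site 3)) x y})
    (fun x y => openConnIn (↑(box 3 (2 * n)) : Set (Site 3)) x y)
    (bondPercolation (zdGraph 3) (criticalProbI 3))
    (fun x => measurableSet_toBdry (2 * n) x) (fun x y => DCT16.measurableSet_openConnIn _ x y)
    (fun x y ω hx hxy => ?_) hc hn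
  -- transitivity: y ↔ x ↔ ∂ inside B(2n)
  obtain ⟨z, hz, hxz⟩ := hx
  obtain ⟨hxm, hym, hpath⟩ := hxy
  obtain ⟨hxm', hzm, hpath'⟩ := hxz
  exact ⟨z, hz, hym, hzm, hpath.symm.trans hpath'⟩

end Summit.CriticalPhenomena.PercolationContinuityZ3.Cruxes.ArmMassNSA.SplitNonproliferationWeaker

end
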